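import Summits.QuantumAdvantage.QuantumAdvantage.Theorems.SosSandwichPseudoBoundedAALevelTwoDecoupling
import HarnessLib

/-!
# Route `SosSandwich`, crux `PseudoBoundedAA` (stmt-QuantumAdvantage-15237): the LEVEL-TWO RUNG of the AA ladder

Part 2 (part 1 = `Theorems/SosSandwichPseudoBoundedAALevelTwoDecoupling.lean`: sup norm of the level-2 part,
decoupling, uniform row-sum bound).  **Every `[0,1]`-bounded real polynomial `p` of total degree `≤ d` on
`{0,1}^N` (`N ≥ 1`) has a variable with `16·W₂[p]² ≤ 9·d⁶·Inf_i[p]`**, where `W₂[p] = Σ_{|S|=2} p̂(S)²` is the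
level-2 Fourier weight — an Aaronson–Ambainis-type bound with the SHARP exponent `2` in the weight and a
polynomial loss in the degree, valid on all bounded low-degree functions (so on `K_T`, `d = 2T`:
`W₂² ≤ 36·T⁶·maxᵢ Infᵢ`, and on `Q_T`).  With the level-1 rung (`…LevelOneRung.lean`) and the landed
degree-free top rungs (levels `2T`, `2T-1` on `Q_T`), at `T = 2` EVERY Fourier level `1 … 4` of a two-query
acceptance polynomial now carries a polynomial-loss rung; in general the middle levels `3 … 2T-2` remain.

* §3 `sq_sum_le_of_isLevelLE_one`, `khintchine_bonami` — **Khintchine's inequality from Bonami's lemma** (tree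
  `IsLevelLE.bonami_even_moment`, `r = 2`, level `1`): `2^N·√(Σ_k a_k²) ≤ 3·Σ_u |Σ_k a_k χ_k(u)|`
  (Hölder via two Cauchy–Schwarz steps).
* §4 `exists_influence_ge_levelTwo` — rows `r_i² = Σ_{k≠i} p̂({i,k})² ≤ Inf_i/4`, `Σ_i r_i² = 2W₂`,
  `Σ_i r_i ≤ 3·d³` (Khintchine per row, averaged, against the uniform row-sum bound `d³` of part 1 with
  `M = 1/2`), hence `2W₂ ≤ 3d³·maxᵢ rᵢ` and `16 W₂² ≤ 9 d⁶ · maxᵢ Infᵢ`.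
* §5 `exists_influence_ge_levelTwo_pseudoBounded` (`K_T`), `levelTwo_share_pseudoBoundedAA` (PB-AA's literal
  conclusion with `(c, C) = (6, η²/36)` on the level-2 share `η`, and the sharper `η²ε²/(36T⁶) ≤ Inf`),
  `exists_influence_ge_levelTwo_query` (`Q_T`).

Honest label: a support lemma (new rung); no stub, crux or summit is proved.  Sources: O'Donnell 2014 Thm. 9.21
(Bonami), §2.2; Littlewood 1930 (the mixed-norm / `4/3` inequality, whose first step this is); Kaniewski–Lee–de
Wolf 2015 Def. 7; Beals et al. 2001 Lemma 4.1; Aaronson–Ambainis 2014 Conj. 6.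
-/

-- D-0017: single-conjunct summit ⇒ the duplicate `QuantumAdvantage.QuantumAdvantage` is mandated.
set_option linter.dupNamespace false

noncomputable section

namespace Summit.QuantumAdvantage.QuantumAdvantage.Theorems.SosSandwich.LevelTwoRung

open Finset
open Literature.Computability.QuantumComplexity
open Literature.Computability.Complexity.LowDegree (cubeFourierCoeff sum_cubeFourierCoeff_mul_walsh
  sum_walsh_mul_walsh_index IsLevelLE isLevelLE_walsh)
open Literature.Probability.RandomGraphs.LowDegree (sgn walsh sgn_true sgn_false walsh_empty)
open Literature.Computability.Cryptography (QQueryAlg)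
open Summit.QuantumAdvantage.QuantumAdvantage.Theorems.SosSandwich.LevelOneRung

variable {N : ℕ}

/-! ### §3 Khintchine's inequality from Bonami's lemma -/

/-- A Rademacher sum `u ↦ Σ_k a_k χ_k(u)` has Fourier level `≤ 1`. [cite: ODonnell2014, §1.4] -/
theorem isLevelLE_one_linear (a : Fin N → ℝ) (B : Finset (Fin N)) :
    IsLevelLE 1 (fun u : Fin N → Bool => ∑ k ∈ B, a k * sgn (u k)) := by
  have h : IsLevelLE 1 (fun u : Fin N → Bool => ∑ k ∈ B, a k * walsh {k} u) :=
    IsLevelLE.sum B fun k _ => (isLevelLE_walsh {k} (by simp)).const_mul (a k)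
  have heq : (fun u : Fin N → Bool => ∑ k ∈ B, a k * sgn (u k)) =
      (fun u : Fin N → Bool => ∑ k ∈ B, a k * walsh {k} u) := by
    funext u
    exact Finset.sum_congr rfl fun k _ => by rw [walsh, Finset.prod_singleton]
  rw [heq]; exact h

/-- The second moment of a Rademacher sum: `Σ_u (Σ_k a_k χ_k(u))² = 2^N Σ_k a_k²`. [cite: ODonnell2014, §1.4 (Parseval)] -/
theorem sum_sq_linear (a : Fin N → ℝ) (B : Finset (Fin N)) :
    ∑ u : Fin N → Bool, (∑ k ∈ B, a k * sgn (u k)) ^ 2 = (2 : ℝ) ^ N * ∑ k ∈ B, a k ^ 2 := by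
  have hw : ∀ (u : Fin N → Bool) (k : Fin N), sgn (u k) = walsh {k} u := fun u k => by
    rw [walsh, Finset.prod_singleton]
  calc ∑ u : Fin N → Bool, (∑ k ∈ B, a k * sgn (u k)) ^ 2
      = ∑ u : Fin N → Bool, ∑ k ∈ B, ∑ l ∈ B, a k * a l * (walsh {k} u * walsh {l} u) := by
        refine Finset.sum_congr rfl fun u _ => ?_
        rw [sq, Finset.sum_mul_sum]
        refine Finset.sum_congr rfl fun k _ => Finset.sum_congr rfl fun l _ => ?_
        rw [hw, hw]; ring
    _ = ∑ k ∈ B, ∑ l ∈ B, a k * a l * ∑ u : Fin N → Bool, walsh {k} u * walsh {l} u := by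
        rw [Finset.sum_comm]
        refine Finset.sum_congr rfl fun k _ => ?_
        rw [Finset.sum_comm]
        refine Finset.sum_congr rfl fun l _ => ?_
        rw [Finset.mul_sum]
    _ = ∑ k ∈ B, a k * a k * (2 : ℝ) ^ N := by
        refine Finset.sum_congr rfl fun k hk => ?_
        simp_rw [sum_walsh_mul_walsh_index, Finset.singleton_inj]
        simp [Finset.sum_ite_eq, hk]
    _ = (2 : ℝ) ^ N * ∑ k ∈ B, a k ^ 2 := by
        rw [Finset.mul_sum]
        exact Finset.sum_congr rfl fun k _ => by ring

/-- **Hölder step for level `≤ 1`**: `(Σ_u h²)·2^N ≤ 9 (Σ_u |h|)²` — from `E h² ≤ (E|h|)^{2/3}(E h⁴)^{1/3}`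
(two Cauchy–Schwarz steps) and Bonami's `E h⁴ ≤ 9 (E h²)²`. [cite: ODonnell2014, Thm. 9.21 and §9.1] -/
theorem sq_sum_le_of_isLevelLE_one (h : (Fin N → Bool) → ℝ) (hh : IsLevelLE 1 h) :
    (∑ u, h u ^ 2) * (2 : ℝ) ^ N ≤ 9 * (∑ u, |h u|) ^ 2 := by
  have h2N : (0 : ℝ) < (2 : ℝ) ^ N := by positivity
  have hB := hh.bonami_even_moment 2 (by norm_num)
  have h9 : (2 * ((2 : ℕ) : ℝ) - 1) ^ (2 * 1) = (9 : ℝ) := by norm_num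
  rw [h9] at hB
  set S2 := ∑ u, h u ^ 2 with hS2
  set S1 := ∑ u, |h u| with hS1
  set S3 := ∑ u, |h u| ^ 3 with hS3
  set S4 := ∑ u, (h u ^ 2) ^ 2 with hS4
  have hS2nn : 0 ≤ S2 := Finset.sum_nonneg fun u _ => sq_nonneg _
  have hS1nn : 0 ≤ S1 := Finset.sum_nonneg fun u _ => abs_nonneg _
  -- Bonami: `S4 · 2^N ≤ 9 S2²`
  have h4 : S4 * (2 : ℝ) ^ N ≤ 9 * S2 ^ 2 := by
    rw [div_le_iff₀ h2N] at hB
    have e : 9 * (S2 / (2 : ℝ) ^ N) ^ 2 * (2 : ℝ) ^ N = 9 * S2 ^ 2 / (2 : ℝ) ^ N := by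
      field_simp
    rw [e, le_div_iff₀ h2N] at hB
    exact hB
  -- Cauchy–Schwarz twice: `S2² ≤ S1·S3` and `S3² ≤ S2·S4`
  have cs1 : S2 ^ 2 ≤ S1 * S3 := by
    have := Finset.sum_mul_sq_le_sq_mul_sq univ (fun u => Real.sqrt |h u|) (fun u => |h u| * Real.sqrt |h u|)
    have e1 : ∀ u, Real.sqrt |h u| * (|h u| * Real.sqrt |h u|) = h u ^ 2 := fun u => by
      have hs := Real.mul_self_sqrt (abs_nonneg (h u))
      calc Real.sqrt |h u| * (|h u| * Real.sqrt |h u|)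
          = (Real.sqrt |h u| * Real.sqrt |h u|) * |h u| := by ring
        _ = |h u| * |h u| := by rw [hs]
        _ = h u ^ 2 := by rw [← sq, sq_abs]
    have e2 : ∀ u, Real.sqrt |h u| ^ 2 = |h u| := fun u => Real.sq_sqrt (abs_nonneg _)
    have e3 : ∀ u, (|h u| * Real.sqrt |h u|) ^ 2 = |h u| ^ 3 := fun u => by
      rw [mul_pow, Real.sq_sqrt (abs_nonneg _)]; ring
    simp_rw [e1, e2, e3] at this
    exact this
  have cs2 : S3 ^ 2 ≤ S2 * S4 := by
    have := Finset.sum_mul_sq_le_sq_mul_sq univ (fun u => |h u|) (fun u => h u ^ 2)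
    have e1 : ∀ u, |h u| * h u ^ 2 = |h u| ^ 3 := fun u => by rw [← sq_abs]; ring
    have e2 : ∀ u, |h u| ^ 2 = h u ^ 2 := fun u => sq_abs _
    simp_rw [e1, e2] at this
    exact this
  by_cases hS2z : S2 = 0
  · rw [hS2z, zero_mul]; positivity
  have hS2pos : 0 < S2 := lt_of_le_of_ne hS2nn (Ne.symm hS2z)
  have i12 : S2 ^ 4 ≤ S1 ^ 2 * (S2 * S4) :=
    calc S2 ^ 4 = (S2 ^ 2) ^ 2 := by ring
      _ ≤ (S1 * S3) ^ 2 := pow_le_pow_left₀ (by positivity) cs1 2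
      _ = S1 ^ 2 * S3 ^ 2 := by ring
      _ ≤ S1 ^ 2 * (S2 * S4) := mul_le_mul_of_nonneg_left cs2 (by positivity)
  have i3 : S2 ^ 4 * (2 : ℝ) ^ N ≤ S1 ^ 2 * S2 * (9 * S2 ^ 2) :=
    calc S2 ^ 4 * (2 : ℝ) ^ N ≤ S1 ^ 2 * (S2 * S4) * (2 : ℝ) ^ N := mul_le_mul_of_nonneg_right i12 h2N.le
      _ = S1 ^ 2 * S2 * (S4 * (2 : ℝ) ^ N) := by ring
      _ ≤ S1 ^ 2 * S2 * (9 * S2 ^ 2) := mul_le_mul_of_nonneg_left h4 (by positivity)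
  have hS23 : 0 < S2 ^ 3 := pow_pos hS2pos 3
  have hfin : S2 * (2 : ℝ) ^ N * S2 ^ 3 ≤ 9 * S1 ^ 2 * S2 ^ 3 :=
    calc S2 * (2 : ℝ) ^ N * S2 ^ 3 = S2 ^ 4 * (2 : ℝ) ^ N := by ring
      _ ≤ S1 ^ 2 * S2 * (9 * S2 ^ 2) := i3
      _ = 9 * S1 ^ 2 * S2 ^ 3 := by ring
  exact le_of_mul_le_mul_right hfin hS23

/-- **Khintchine's inequality (constant `3`) from Bonami's lemma**: `2^N √(Σ_k a_k²) ≤ 3 Σ_u |Σ_k a_k χ_k(u)|`.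
[cite: ODonnell2014, Thm. 9.21 (Bonami) and §9.1] -/
theorem khintchine_bonami (a : Fin N → ℝ) (B : Finset (Fin N)) :
    (2 : ℝ) ^ N * Real.sqrt (∑ k ∈ B, a k ^ 2) ≤ 3 * ∑ u : Fin N → Bool, |∑ k ∈ B, a k * sgn (u k)| := by
  have key := sq_sum_le_of_isLevelLE_one _ (isLevelLE_one_linear a B)
  rw [sum_sq_linear] at key
  have hsq : ((2 : ℝ) ^ N * Real.sqrt (∑ k ∈ B, a k ^ 2)) ^ 2 ≤
      (3 * ∑ u : Fin N → Bool, |∑ k ∈ B, a k * sgn (u k)|) ^ 2 :=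
    calc ((2 : ℝ) ^ N * Real.sqrt (∑ k ∈ B, a k ^ 2)) ^ 2
        = (2 : ℝ) ^ N * (∑ k ∈ B, a k ^ 2) * (2 : ℝ) ^ N := by
          rw [mul_pow, Real.sq_sqrt (Finset.sum_nonneg fun k _ => sq_nonneg _)]; ring
      _ ≤ 9 * (∑ u : Fin N → Bool, |∑ k ∈ B, a k * sgn (u k)|) ^ 2 := key
      _ = (3 * ∑ u : Fin N → Bool, |∑ k ∈ B, a k * sgn (u k)|) ^ 2 := by ring
  exact (pow_le_pow_iff_left₀ (by positivity) (by positivity) two_ne_zero).mp hsq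

/-! ### §4 The level-two rung: `16·W₂[p]² ≤ 9·d⁶·maxᵢ Inf_i[p]` -/

/-- Row weights are dominated by the influence: `4 Σ_{k ≠ i} p̂({i,k})² ≤ Inf_i[p]`
(`Inf_i = 4 Σ_{S ∋ i} p̂(S)²`). [cite: ODonnell2014, §2.2 (Fourier formula for influences)] -/
theorem four_mul_rowWeight_le_influence (p : MvPolynomial (Fin N) ℝ) (i : Fin N) :
    4 * ∑ k ∈ univ.erase i, cubeFourierCoeff (evalBool p) {i, k} ^ 2 ≤ influence i p := by
  classical
  rw [influence_eq_sum_sq_fourier]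
  refine mul_le_mul_of_nonneg_left ?_ (by norm_num)
  have hmem : i ∈ (univ : Finset (Fin N)) := Finset.mem_univ i
  calc ∑ k ∈ univ.erase i, cubeFourierCoeff (evalBool p) {i, k} ^ 2
      = ∑ S ∈ ((univ : Finset (Fin N)).powersetCard 2).filter (fun S => i ∈ S),
          cubeFourierCoeff (evalBool p) S ^ 2 :=
        (sum_powersetCard_two_containing univ hmem (fun S => cubeFourierCoeff (evalBool p) S ^ 2)).symm
    _ ≤ ∑ S ∈ univ.filter (fun S : Finset (Fin N) => i ∈ S), cubeFourierCoeff (evalBool p) S ^ 2 := by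
        apply Finset.sum_le_sum_of_subset_of_nonneg
        · intro S hS
          rw [Finset.mem_filter] at hS ⊢
          exact ⟨Finset.mem_univ _, hS.2⟩
        · intro S _ _
          exact sq_nonneg _

/-- The size-2 subsets of `univ` are the sets of size `2`. [folklore] -/
theorem powersetCard_two_univ :
    (univ : Finset (Fin N)).powersetCard 2 = univ.filter (fun S : Finset (Fin N) => S.card = 2) := by
  ext S
  simp [Finset.mem_powersetCard]

/-- `Σ_u const = 2^N · const` over the cube `{0,1}^N`. [folklore] -/
theorem sum_cube_const (c : ℝ) : ∑ _u : Fin N → Bool, c = (2 : ℝ) ^ N * c := by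
  simp [Finset.card_univ, Fintype.card_fin]

/-- **The level-two rung.**  For a real polynomial `p` of total degree `≤ d` with `0 ≤ p ≤ 1` on the cube
`{0,1}^N`, `N ≥ 1`, some variable `i` has `16·W₂[p]² ≤ 9·d⁶·Inf_i[p]`, where
`W₂[p] = Σ_{|S|=2} p̂(S)²` is the level-2 Fourier weight.  (Rows `r_i = (Σ_{k≠i} p̂({i,k})²)^{1/2}`:
`Σ_i r_i ≤ 3·d³` by Khintchine–Bonami and the decoupled level-2 bound, `Σ_i r_i² = 2 W₂`, so
`2 W₂ ≤ 3 d³ · maxᵢ rᵢ` and `4 rᵢ² ≤ Infᵢ`.) [cite: ODonnell2014, Thm. 9.21, §3.3, §2.2]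
[cite: Korneichuk1991, Prop 3.5.7 and Thm 3.5.8 (§3.5.4)] [cite: AaronsonAmbainis2014, Conj. 6] -/
theorem exists_influence_ge_levelTwo {d : ℕ} {p : MvPolynomial (Fin N) ℝ} (hN : 0 < N)
    (hp : p.totalDegree ≤ d) (hb : ∀ x, 0 ≤ evalBool p x ∧ evalBool p x ≤ 1) :
    ∃ i : Fin N, 16 * (∑ S ∈ univ.filter (fun S : Finset (Fin N) => S.card = 2),
        cubeFourierCoeff (evalBool p) S ^ 2) ^ 2 ≤ 9 * (d : ℝ) ^ 6 * influence i p := by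
  classical
  haveI : Nonempty (Fin N) := Fin.pos_iff_nonempty.mp hN
  -- the centred function `g = p - 1/2`, `|g| ≤ 1/2`, Fourier degree `≤ d`, same coefficients at `S ≠ ∅`
  have hM : ∀ x, |evalBool p x - 1 / 2| ≤ 1 / 2 := fun x => by
    rw [abs_le]; constructor <;> linarith [(hb x).1, (hb x).2]
  have hdeg : IsLevelLE d (fun x => evalBool p x - 1 / 2) := fun S hS => by
    have hS0 : S ≠ ∅ := by rintro rfl; simp at hS
    rw [cubeFourierCoeff_sub_const _ hS0]
    exact cubeFourierCoeff_evalBool_eq_zero hp hS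
  have hpair : ∀ i k : Fin N, cubeFourierCoeff (fun x => evalBool p x - 1 / 2) {i, k} =
      cubeFourierCoeff (evalBool p) {i, k} := fun i k =>
    cubeFourierCoeff_sub_const _ (Finset.insert_ne_empty i {k})
  -- the decoupled level-2 bound: every row sum is `≤ d³` uniformly in `u`
  have hL := abs_levelTwo_sum_le hdeg hM
  have hrows : ∀ u : Fin N → Bool,
      ∑ i, |∑ k ∈ univ.erase i, cubeFourierCoeff (evalBool p) {i, k} * sgn (u k)| ≤ (d : ℝ) ^ 3 := by
    intro u
    have h := sum_abs_row_le hL u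
    simp_rw [hpair] at h
    linarith
  -- rows `r_i`
  set a : Fin N → Fin N → ℝ := fun i k => cubeFourierCoeff (evalBool p) {i, k} with ha
  set r : Fin N → ℝ := fun i => Real.sqrt (∑ k ∈ univ.erase i, a i k ^ 2) with hr
  have hr0 : ∀ j, 0 ≤ r j := fun j => Real.sqrt_nonneg _
  have hrsq : ∀ j, r j ^ 2 = ∑ k ∈ univ.erase j, a j k ^ 2 := fun j =>
    Real.sq_sqrt (Finset.sum_nonneg fun k _ => sq_nonneg _)
  -- `Σ_i r_i ≤ 3 d³`
  have hsumr : ∑ j, r j ≤ 3 * (d : ℝ) ^ 3 := by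
    have h2N : (0 : ℝ) < (2 : ℝ) ^ N := by positivity
    have h1 : ∀ j, (2 : ℝ) ^ N * r j ≤ 3 * ∑ u : Fin N → Bool, |∑ k ∈ univ.erase j, a j k * sgn (u k)| :=
      fun j => khintchine_bonami (a j) (univ.erase j)
    have h2 : (2 : ℝ) ^ N * ∑ j, r j ≤ 3 * ∑ u : Fin N → Bool, ∑ j, |∑ k ∈ univ.erase j, a j k * sgn (u k)| := by
      rw [Finset.mul_sum, Finset.sum_comm, Finset.mul_sum]
      exact Finset.sum_le_sum fun j _ => h1 j
    have h3 : ∑ u : Fin N → Bool, ∑ j, |∑ k ∈ univ.erase j, a j k * sgn (u k)| ≤ (2 : ℝ) ^ N * (d : ℝ) ^ 3 := by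
      rw [← sum_cube_const]
      exact Finset.sum_le_sum fun u _ => hrows u
    have h4 : (2 : ℝ) ^ N * ∑ j, r j ≤ (2 : ℝ) ^ N * (3 * (d : ℝ) ^ 3) := by nlinarith [h2, h3]
    exact le_of_mul_le_mul_left h4 h2N
  -- `Σ_i r_i² = 2 W₂`
  have hW2 : ∑ j, r j ^ 2 =
      2 * ∑ S ∈ univ.filter (fun S : Finset (Fin N) => S.card = 2), cubeFourierCoeff (evalBool p) S ^ 2 := by
    simp_rw [hrsq]
    rw [← powersetCard_two_univ]
    exact sum_sum_erase_pair univ (fun S => cubeFourierCoeff (evalBool p) S ^ 2)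
  -- the maximal row
  obtain ⟨i, -, hi⟩ := Finset.exists_max_image Finset.univ r Finset.univ_nonempty
  refine ⟨i, ?_⟩
  have hmax : ∀ j, r j ≤ r i := fun j => hi j (Finset.mem_univ j)
  have hsq_le : ∑ j, r j ^ 2 ≤ r i * (3 * (d : ℝ) ^ 3) :=
    calc ∑ j, r j ^ 2 = ∑ j, r j * r j := Finset.sum_congr rfl fun j _ => sq (r j)
      _ ≤ ∑ j, r i * r j := Finset.sum_le_sum fun j _ => mul_le_mul_of_nonneg_right (hmax j) (hr0 j)
      _ = r i * ∑ j, r j := by rw [Finset.mul_sum]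
      _ ≤ r i * (3 * (d : ℝ) ^ 3) := mul_le_mul_of_nonneg_left hsumr (hr0 i)
  have hinf : 4 * r i ^ 2 ≤ influence i p := by
    rw [hrsq]; exact four_mul_rowWeight_le_influence p i
  set W := ∑ S ∈ univ.filter (fun S : Finset (Fin N) => S.card = 2), cubeFourierCoeff (evalBool p) S ^ 2
    with hW
  have hW0 : 0 ≤ W := Finset.sum_nonneg fun S _ => sq_nonneg _
  have h2W : 2 * W ≤ r i * (3 * (d : ℝ) ^ 3) := by rw [← hW2]; exact hsq_le
  have hsq : (2 * W) ^ 2 ≤ (r i * (3 * (d : ℝ) ^ 3)) ^ 2 := pow_le_pow_left₀ (by positivity) h2W 2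
  calc 16 * W ^ 2 = 4 * (2 * W) ^ 2 := by ring
    _ ≤ 4 * (r i * (3 * (d : ℝ) ^ 3)) ^ 2 := by linarith
    _ = 9 * (d : ℝ) ^ 6 * (4 * r i ^ 2) := by ring
    _ ≤ 9 * (d : ℝ) ^ 6 * influence i p := mul_le_mul_of_nonneg_left hinf (by positivity)

/-! ### §5 On `K_T` and `Q_T` -/

/-- **The level-two rung on `K_T`.**  Every pseudo-bounded `p` of order `T` on `N ≥ 1` bits has a variable
with `W₂[p]² ≤ 36·T⁶·Inf_i[p]` (`d = 2T` in `exists_influence_ge_levelTwo`).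
[cite: KaniewskiLeeDewolf2015, Def. 7] [cite: ODonnell2014, Thm. 9.21] [cite: AaronsonAmbainis2014, Conj. 6] -/
theorem exists_influence_ge_levelTwo_pseudoBounded {T : ℕ} {p : MvPolynomial (Fin N) ℝ} (hN : 0 < N)
    (h : PseudoBounded T p) :
    ∃ i : Fin N, (∑ S ∈ univ.filter (fun S : Finset (Fin N) => S.card = 2),
        cubeFourierCoeff (evalBool p) S ^ 2) ^ 2 ≤ 36 * (T : ℝ) ^ 6 * influence i p := by
  obtain ⟨p', hdeg, hb, heq⟩ := exists_representative_of_pseudoBounded h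
  obtain ⟨i, hi⟩ := exists_influence_ge_levelTwo hN hdeg hb
  refine ⟨i, ?_⟩
  have hinf : influence i p' = influence i p := by unfold influence; rw [heq]
  rw [heq, hinf] at hi
  have h4 : 9 * ((2 * T : ℕ) : ℝ) ^ 6 * influence i p = 16 * (36 * ((T : ℝ) ^ 6 * influence i p)) := by
    push_cast; ring
  rw [h4] at hi
  linarith

/-- **PB-AA's conclusion on the level-2 share.**  For every `η > 0`: if `p ∈ K_T` (`T ≥ 1`) has
`Var[p] ≥ ε > 0` and its level-2 Fourier weight carries the share `η` of the variance (`η·Var[p] ≤ W₂[p]`),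
then some variable has `η²ε²/(36 T⁶) ≤ Inf_i[p]` (sharp exponent `2` in `ε`), and in particular the
literal conclusion `C (ε/T)^c ≤ Inf_i[p]` of the crux `PseudoBoundedAA` with `(c, C) = (6, η²/36)`
(`ε ≤ Var ≤ 1`). [cite: AaronsonAmbainis2014, Conj. 6] [cite: ODonnell2014, Thm. 9.21] -/
theorem levelTwo_share_pseudoBoundedAA {η : ℝ} (hη : 0 < η) (N T : ℕ) (p : MvPolynomial (Fin N) ℝ)
    (ε : ℝ) (hT : 1 ≤ T) (h : PseudoBounded T p) (hε : 0 < ε) (hv : ε ≤ boolVariance p)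
    (hshare : η * boolVariance p ≤
      ∑ S ∈ univ.filter (fun S : Finset (Fin N) => S.card = 2), cubeFourierCoeff (evalBool p) S ^ 2) :
    ∃ i : Fin N, η ^ 2 * ε ^ 2 / (36 * (T : ℝ) ^ 6) ≤ influence i p ∧
      η ^ 2 / 36 * (ε / T) ^ 6 ≤ influence i p := by
  rcases Nat.eq_zero_or_pos N with hN0 | hN
  · exfalso
    subst hN0
    have h0 : ∑ S ∈ univ.filter (fun S : Finset (Fin 0) => S.card = 2),
        cubeFourierCoeff (evalBool p) S ^ 2 = 0 := by
      refine Finset.sum_eq_zero fun S hS => ?_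
      rw [Finset.mem_filter] at hS
      have : S.card = 0 := by
        rw [Finset.card_eq_zero]; exact Finset.eq_empty_of_isEmpty S
      omega
    rw [h0] at hshare
    nlinarith [mul_pos hη (lt_of_lt_of_le hε hv)]
  obtain ⟨i, hi⟩ := exists_influence_ge_levelTwo_pseudoBounded hN h
  refine ⟨i, ?_, ?_⟩
  · have hTpos : (0 : ℝ) < T := by exact_mod_cast hT
    have hW : η * ε ≤ ∑ S ∈ univ.filter (fun S : Finset (Fin N) => S.card = 2),
        cubeFourierCoeff (evalBool p) S ^ 2 :=
      le_trans (mul_le_mul_of_nonneg_left hv hη.le) hshare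
    have hsq : (η * ε) ^ 2 ≤ (∑ S ∈ univ.filter (fun S : Finset (Fin N) => S.card = 2),
        cubeFourierCoeff (evalBool p) S ^ 2) ^ 2 := pow_le_pow_left₀ (by positivity) hW 2
    rw [div_le_iff₀ (by positivity)]
    calc η ^ 2 * ε ^ 2 = (η * ε) ^ 2 := by ring
      _ ≤ 36 * (T : ℝ) ^ 6 * influence i p := hsq.trans hi
      _ = influence i p * (36 * (T : ℝ) ^ 6) := by ring
  · -- `(ε/T)^6 ≤ ε²/T⁶` since `ε ≤ Var ≤ 1`
    have hTpos : (0 : ℝ) < T := by exact_mod_cast hT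
    have hv1 : boolVariance p ≤ 1 := by
      have := boolVariance_le_quarter h
      linarith
    have hε1 : ε ≤ 1 := hv.trans hv1
    have hW : η * ε ≤ ∑ S ∈ univ.filter (fun S : Finset (Fin N) => S.card = 2),
        cubeFourierCoeff (evalBool p) S ^ 2 :=
      le_trans (mul_le_mul_of_nonneg_left hv hη.le) hshare
    have hsq : (η * ε) ^ 2 ≤ (∑ S ∈ univ.filter (fun S : Finset (Fin N) => S.card = 2),
        cubeFourierCoeff (evalBool p) S ^ 2) ^ 2 := pow_le_pow_left₀ (by positivity) hW 2
    have hε6 : ε ^ 6 ≤ ε ^ 2 := by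
      have : ε ^ 4 ≤ 1 := pow_le_one₀ hε.le hε1
      nlinarith [pow_pos hε 2]
    have key : (η * ε) ^ 2 ≤ 36 * (T : ℝ) ^ 6 * influence i p := hsq.trans hi
    rw [div_pow]
    have hT6 : (0 : ℝ) < (T : ℝ) ^ 6 := by positivity
    rw [show η ^ 2 / 36 * (ε ^ 6 / (T : ℝ) ^ 6) = η ^ 2 * ε ^ 6 / (36 * (T : ℝ) ^ 6) by ring,
      div_le_iff₀ (by positivity)]
    calc η ^ 2 * ε ^ 6 ≤ η ^ 2 * ε ^ 2 := mul_le_mul_of_nonneg_left hε6 (by positivity)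
      _ = (η * ε) ^ 2 := by ring
      _ ≤ 36 * (T : ℝ) ^ 6 * influence i p := key
      _ = influence i p * (36 * (T : ℝ) ^ 6) := by ring

/-- **The level-two rung on `Q_T`.**  For every quantum algorithm making `T` queries to `N ≥ 1` bits and every
real polynomial `p` with `Q`'s acceptance probabilities as cube values, some variable has
`W₂[p]² ≤ 36·T⁶·Inf_i[p]` (the acceptance polynomial has total degree `≤ 2T` and values in `[0,1]`, tree
`exists_acceptPolynomial`). [cite: BealsEtAl2001, Lemma 4.1] [cite: ODonnell2014, Thm. 9.21]
[cite: AaronsonAmbainis2014, Conj. 6] -/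
theorem exists_influence_ge_levelTwo_query (hN : 0 < N) (Q : QQueryAlg N) (p : MvPolynomial (Fin N) ℝ)
    (hp : ∀ x, evalBool p x = Q.acceptProb x) :
    ∃ i : Fin N, (∑ S ∈ univ.filter (fun S : Finset (Fin N) => S.card = 2),
        cubeFourierCoeff (evalBool p) S ^ 2) ^ 2 ≤ 36 * (Q.queries : ℝ) ^ 6 * influence i p := by
  obtain ⟨p₀, hdeg, hval⟩ := exists_acceptPolynomial Q
  have heq : evalBool p = evalBool p₀ := funext fun x => by rw [hp x]; exact hval x
  have hb : ∀ x, 0 ≤ evalBool p₀ x ∧ evalBool p₀ x ≤ 1 := fun x => by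
    have hx : evalBool p₀ x = Q.acceptProb x := (hval x).symm
    rw [hx]
    exact ⟨Q.acceptProb_nonneg x, Q.acceptProb_le_one' x⟩
  obtain ⟨i, hi⟩ := exists_influence_ge_levelTwo hN hdeg hb
  refine ⟨i, ?_⟩
  have hinf : influence i p = influence i p₀ := by unfold influence; rw [heq]
  rw [heq, hinf]
  have h4 : 9 * ((2 * Q.queries : ℕ) : ℝ) ^ 6 * influence i p₀ =
      16 * (36 * ((Q.queries : ℝ) ^ 6 * influence i p₀)) := by
    push_cast; ring
  rw [h4] at hi
  linarith

end Summit.QuantumAdvantage.QuantumAdvantage.Theorems.SosSandwich.LevelTwoRung
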